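import Summits.QuantumFields.BalabanUV.Beta.GAN24.LinStepCharge
import Summits.QuantumFields.BalabanUV.Beta.GAN24.Push4Irr

/-!
# `BalabanUV.Beta.GAN24.TransportIrrelevant` — binder row G-an2-4 / (CONV-C), W-slot road «W3», **ROW W3-F3b (T-irr)** (gan24-p1-g5 `SKELETON-W3.md`
# v1.0.2 §8.3 ∕ §8.5 ∕ §8.6 ∕ (R14-7) ∕ (N-F3b); journal INTENT «W3-TIRR*» l.7944): **THE `k`-FOLD TRANSPORT OF THE NORMALISED `T₂`-RECURSION CONTRACTS,
# ONE FACTOR `Lc⁻¹` PER COMPOSITE-PUSH STEP, ON JOINTLY `Lc`-COVARIANT `LocStencil₂` TABLES WITH VANISHING FIELD–FIELD ZERO MODE, UNDER THE PIN** —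
# `LocStencil₂ (transport A m k X) (CT′·C·(Lc⁻¹)^k) δT` uniformly in `(m, k)` at `d = 3`

NOT IN PRINT; OUR PROOF ([folklore] assembly).  THE CHAIN (leaf-10-g17's `TransportMarginal` §0–§2 VERBATIM, its §3 core-a call replaced): `k = 0` identity;
the first step is general (`TransportMarginal.step_shape`, no gain) and its output is PERIOD-1 covariant with vanishing field–field charge
(`LinStepCharge.step_translate_one` ∕ `zmode_one_step_eq_zero` — leaf-02's `LinT2ZeroMode(.Step)`); the remaining `k − 1` steps are `(−c)^{k−1} •` ONE
bond-symmetrised push through the leg chains (`TransportMarginal.transport_eq_smul_symPush` ⨾ leaf-17's `Push4Iter.transport_symPush`), whose legs are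
`±respStep (Lc^{m+1}) (Lc^{m+k})` (`legChain_colH` ∕ `legChain_rowM`) with BOTH of leaf-12's envelopes `RespStepDecay.exists_respStep_decay_and_grad` — sup
`Cr·((Lc^{k−1})^5)⁻¹` and unit-gradient `Cr′·((Lc^{k−1})^6)⁻¹` — fed to THE (T-irr) CORE `Push4Irr.push₄_locStencil₂_of_zff_env` at table period `1` and
relative blocking `L = Lc^{k−1}`: constant `cIrr·Cr³·Cr′·C_Y·L^4·((L^5)⁻¹)³·(L^6)⁻¹`; then `Push4Iter.locStencil₂_symB`, the scalar, and the arithmetic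
`|c|^{k−1}·L^4·(L^5)^{−4} ≤ 1` (`TransportMarginal.geom_le_one` — where the pin enters) times the EXTRA `L⁻¹ = Lc·(Lc⁻¹)^k` — the irrelevance.
`CT′ = Lc·(1 + |c|·cSand·(1 + cIrr 3 (min mK δin/128) κ₁ 1 · Cr³·Cr′))`, `δT = κ₁/72`, `κ₁ = min κ₀ (min mK δin/256)` — free of `(m, k)`, `X`, `C`
((R12-2): `CT′` may and does depend on `Lc`).  0 cited facts, 0 `def`, 0 `def … : Prop`, 0 wall binders.
HONEST FRAMING (cell contract, verbatim): «discharging `BetaPertH` makes Bałaban's UV stability UNCONDITIONAL — a real constructive-QFT result; it is NOT the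
continuum limit and NOT the Clay problem.»  HONEST DEPENDENCY (verbatim): «continuum YM on T⁴ ⇐ BetaPertH ∧ nine spine estimates (0/9 proved); BetaPertH ⇐
(D1) ∧ (D4) ∧ CAP+tail; G-an2-4 gates asym, D1 and NE2/3/4.»  THIS IS ROW W3-F3b ONLY, with the zero-mode hypothesis in the form «jointly `Lc`-covariant ∧
`zmode Lc X κ κ′ (inl κ₁) (inl κ₂) = 0`» (the END's `Zfree` is a parameter; (R14-6)'s `zmode`-form alone would leave the ∀-`X` row false — leaf-16-g12
l.8588); (F2a∕b), (F4a∕b∕d), (F1a∕b) are other rows; NOTHING of «T2Shape» ∕ «T2SupRate» ∕ (hW₂, hW₂all) is discharged here; NOT «W-slot closed»,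
NEVER «G-an2-4 closed»; NOT `BetaPertH`, NOT continuum, NOT Clay.
Unit `b2b-balaban-gan24-formalise-leaf-12` (G-an2-4 formalisation swarm, leaf prover 12, gen 20; ROW W3-F3b holder), 2026-08-20.
-/

noncomputable section

open Literature.MathematicalPhysics.QuantumFieldTheory
open Literature.MathematicalPhysics.QuantumFieldTheory.Balaban1983to89
open Literature.MathematicalPhysics.QuantumFieldTheory.Balaban1983to89.Beta
open B4ContourShift (supNorm supNorm_nonneg)
open ExpKernelCalculus (MKer Decays comp Zl Zl_pos Zl_nonneg shiftK)
open OneStepResolventKernel (Fib)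
open OneStepKernelFamily (colH KInvStep)
open Summit.QuantumFields.BalabanUV.Beta.HessKerDressedUnits (unitK)
open BalabanCompositeJets (LocStencil₂ respStep)
open BalabanStepJetsSucc (mmRead)
open BalabanStepW2 (locStencil₂_smul')
open SecondOrderResponse (vertex2OfK cBi)
open LatticeForm (quo)
open Summit.QuantumFields.BalabanUV.Beta.GAN24.CombesThomas (KStepUnit UnitDecayK sfStep smStep)
open Summit.QuantumFields.BalabanUV.Beta.GAN24.T2RecursionAffine (lin4)
open Summit.QuantumFields.BalabanUV.Beta.GAN24.Push4 (rowM push₄ IsFF)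
open Summit.QuantumFields.BalabanUV.Beta.GAN24.Push4Bounds (LegDecay legDecay_colH legDecay_rowM)
open Summit.QuantumFields.BalabanUV.Beta.GAN24.Push4Iter (BiTab symB legChain locStencil₂_symB transport_symPush)
open Summit.QuantumFields.BalabanUV.Beta.GAN24.AffineUnroll (transport transport_zero transport_succ')
open Summit.QuantumFields.BalabanUV.Beta.GAN24.RespStepDecay (exists_respStep_decay_and_grad)
open Summit.QuantumFields.BalabanUV.Beta.GAN24.LinSandwichShape (cSand_nonneg)
open Summit.QuantumFields.BalabanUV.Beta.GAN24.TransportMarginal (step_shape step_isFF transport_eq_smul_symPush legChain_colH legChain_rowM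
  abs_legChain_rowM geom_le_one locStencil₂_weaken)
open Summit.QuantumFields.BalabanUV.Beta.GAN24.BiStencilZeroMode (zmode)
open Summit.QuantumFields.BalabanUV.Beta.GAN24.Push4Irr (cIrr cIrr_nonneg push₄_locStencil₂_of_zff_env)
open Summit.QuantumFields.BalabanUV.Beta.GAN24.LinStepCharge (step_translate_one zmode_one_step_eq_zero)

namespace Summit.QuantumFields.BalabanUV.Beta.GAN24.TransportIrrelevant

section Three

variable {Lc : ℕ} [NeZero Lc] {CK mK : ℝ} {c : ℝ} {A : ℕ → BiTab 3 → BiTab 3}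

/-- **ROW W3-F3b (T-irr) — THE `k`-FOLD TRANSPORT OF THE NORMALISED `T₂`-RECURSION IS IRRELEVANT ON ZERO-MODE-FREE COVARIANT `LocStencil₂` TABLES,
UNIFORMLY IN `(m, k)`, UNDER THE PIN** (gan24-p1-g5's `SKELETON-W3.md` v1.0.2 §8.3 ∕ §8.6; NOT IN PRINT — our proof).  At `d = 3`, for every blocking
`Lc ≥ 1`, the K-slot's uniform decay `UnitDecayK 3 Lc (sfStep Lc) (smStep 3 Lc) CK mK` (`mK > 0`), a scalar with `|c| ≤ Lc^16` (for the scalar of record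
`c = cE₂·Lc^{2(d+1)}` this IS the pin `|cE₂| ≤ Lc^{2(d+1)}`) and the literal one-step maps
`A j X = −(c • mmRead Lc (K̃_j ∘ ½(vertex2OfK K̃_j Lc X κuκ′u′ + vertex2OfK K̃_j Lc X κ′u′κu) ∘ K̃_j))`: there are `CT′ ≥ 0` and `0 < δT ≤ δin` with, FOR ALL
`m k` and ALL tables that are `LocStencil₂ X C δin`, JOINTLY `Lc`-COVARIANT and have VANISHING FIELD–FIELD ZERO MODE `zmode Lc X κ κ′ (inl κ₁) (inl κ₂) = 0`,
`LocStencil₂ (transport A m k X) (CT′·C·(Lc⁻¹)^k) δT` — one factor `Lc⁻¹` per composite-push step (the first, general, step gains nothing; `CT′ ∝ Lc`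
pays for it).  See the module docstring for the chain; the (T-irr) mechanism is `Push4Irr.push₄_locStencil₂_of_zff_env`. -/
theorem transport_irrelevant (hLc : 1 ≤ Lc) (hK : UnitDecayK 3 Lc (sfStep Lc) (smStep 3 Lc) CK mK) (hmK : 0 < mK)
    (hA : ∀ j X κ u κ' u', A j X κ u κ' u' = -(c • mmRead Lc (comp (comp (KStepUnit (d := 3) Lc j)
      ((1 / 2 : ℝ) • (vertex2OfK (KStepUnit (d := 3) Lc j) Lc X κ u κ' u' + vertex2OfK (KStepUnit (d := 3) Lc j) Lc X κ' u' κ u)))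
      (KStepUnit (d := 3) Lc j))))
    {δin : ℝ} (hδin : 0 < δin) :
    ∃ CT δT : ℝ, 0 ≤ CT ∧ 0 < δT ∧ δT ≤ δin ∧ (|c| ≤ (Lc : ℝ) ^ 16 → ∀ (m k : ℕ) (X : BiTab 3) (C : ℝ), 0 ≤ C → LocStencil₂ X C δin →
      (∀ κ u κ' u' t, X κ (u + (Lc : ℤ) • t) κ' (u' + (Lc : ℤ) • t) = shiftK (-((Lc : ℤ) • t)) (X κ u κ' u')) →
      (∀ κ κ' κ₁ κ₂, zmode Lc X κ κ' (Sum.inl κ₁) (Sum.inl κ₂) = 0) →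
      LocStencil₂ (transport A m k X) (CT * C * ((Lc : ℝ)⁻¹) ^ k) δT) := by
  have hK' : ∀ j, Decays (KStepUnit (d := 3) Lc j) CK mK := hK
  have hCK : 0 ≤ CK := (hK' 0).nonneg (Sum.inl 0)
  have hLc0 : (0 : ℝ) < (Lc : ℝ) := by exact_mod_cast hLc
  have hLc1 : (1 : ℝ) ≤ (Lc : ℝ) := by exact_mod_cast hLc
  obtain ⟨κ₀, Cr, Cr', hκ₀, hCr, hCr', hN1, hN1'⟩ := exists_respStep_decay_and_grad (Lc := Lc)
  have hm₀ : 0 < min mK δin := lt_min hmK hδin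
  have hcS := cSand_nonneg (d := 3) hCK hm₀
  set cS : ℝ := (Fintype.card (Fib 3) : ℝ) * ((Fintype.card (Fib 3) : ℝ) * (CK * cBi 3 CK 1 (min mK δin)) *
      Zl (3 + 1) (min mK δin / 32 / 2) * CK) * Zl (3 + 1) (min mK δin / 32 / 4) with hcS_def
  -- the working rate `κ₁ < δY = min mK δin / 128` (the table rate after the first step)
  have hκ₁ : 0 < min κ₀ (min mK δin / 256) := lt_min hκ₀ (by positivity)
  have hκ₁δ : min κ₀ (min mK δin / 256) < min mK δin / 128 := by
    have := min_le_right κ₀ (min mK δin / 256); linarith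
  have hκ₁κ₀ : min κ₀ (min mK δin / 256) ≤ κ₀ := min_le_left _ _
  have hcI := cIrr_nonneg (d := 3) hκ₁ hκ₁δ 1
  set G : ℝ := cIrr 3 (min mK δin / 128) (min κ₀ (min mK δin / 256)) 1 * Cr ^ 3 * Cr' with hG
  have hG0 : 0 ≤ G := by rw [hG]; positivity
  refine ⟨(Lc : ℝ) * (1 + |c| * cS * (1 + G)), min κ₀ (min mK δin / 256) / (6 * (3 + 1)) / 3, by positivity, by positivity, ?_,
    fun hc m k X C hC hX hXcov hZ => ?_⟩
  · have h2 : min mK δin ≤ δin := min_le_right _ _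
    have h3 : min κ₀ (min mK δin / 256) / (6 * (3 + 1)) / 3 ≤ min κ₀ (min mK δin / 256) :=
      (div_le_self (by positivity) (by norm_num)).trans (div_le_self hκ₁.le (by norm_num))
    linarith [min_le_right κ₀ (min mK δin / 256)]
  have hδT_le : min κ₀ (min mK δin / 256) / (6 * (3 + 1)) / 3 ≤ min mK δin / 128 := by
    have h3 : min κ₀ (min mK δin / 256) / (6 * (3 + 1)) / 3 ≤ min κ₀ (min mK δin / 256) :=
      (div_le_self (by positivity) (by norm_num)).trans (div_le_self hκ₁.le (by norm_num))
    linarith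
  cases k with
  | zero =>
    rw [transport_zero, pow_zero, mul_one]
    refine locStencil₂_weaken hX ?_ (hδT_le.trans (by linarith [min_le_right mK δin]))
    have h1 : (1 : ℝ) ≤ (Lc : ℝ) * (1 + |c| * cS * (1 + G)) := by
      have : (1 : ℝ) ≤ 1 + |c| * cS * (1 + G) := by nlinarith [mul_nonneg (mul_nonneg (abs_nonneg c) hcS) (by positivity : (0:ℝ) ≤ 1 + G)]
      nlinarith
    nlinarith
  | succ k' =>
    rw [transport_succ']
    have hY := step_shape hLc hK' hmK hA m hX hδin
    have hYff := step_isFF hA m X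
    have hδY : 0 < min mK δin / 128 := by positivity
    -- the first step's output: period-1 covariant, vanishing field–field charge
    have hYcov := step_translate_one (d := 3) hK' hmK hA m hX hδin hXcov
    have hYZ : ∀ κ κ' κ₁ κ₂, zmode 1 (A m X) κ κ' (Sum.inl κ₁) (Sum.inl κ₂) = 0 :=
      fun κ κ' κ₁ κ₂ => zmode_one_step_eq_zero (d := 3) hK' hmK hA m hX hδin hXcov hZ κ κ' κ₁ κ₂
    cases k' with
    | zero =>
      rw [transport_zero]
      refine locStencil₂_weaken hY ?_ hδT_le
      -- `|c|·cS·C ≤ Lc·(1 + |c|·cS·(1+G))·C·Lc⁻¹`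
      rw [zero_add, pow_one, show (Lc : ℝ) * (1 + |c| * cS * (1 + G)) * C * (Lc : ℝ)⁻¹ = (1 + |c| * cS * (1 + G)) * C by
        field_simp]
      rw [show |c| * (cS * C) = (|c| * cS) * C by ring]
      refine mul_le_mul_of_nonneg_right ?_ hC
      nlinarith [mul_nonneg (mul_nonneg (abs_nonneg c) hcS) hG0, mul_nonneg (abs_nonneg c) hcS]
    | succ k'' =>
      have hYmem : (∀ κ u κ' u', IsFF (A m X κ u κ' u')) ∧ ∃ C δ : ℝ, 0 < δ ∧ LocStencil₂ (A m X) C δ := ⟨hYff, _, _, hδY, hY⟩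
      have hlegs : ∀ j, ∃ C m : ℝ, 0 < m ∧ LegDecay (rowM (KStepUnit (d := 3) Lc j) Lc) Lc C m :=
        fun j => ⟨CK, mK, hmK, legDecay_rowM (hK' j)⟩
      have hlegs' : ∀ j, ∃ C m : ℝ, 0 < m ∧ LegDecay (colH (KStepUnit (d := 3) Lc j) Lc) Lc C m :=
        fun j => ⟨CK, mK, hmK, legDecay_colH (hK' j)⟩
      rw [transport_eq_smul_symPush hK' hmK hA (m + 1) (k'' + 1) hYmem,
        transport_symPush hLc hlegs hlegs' ⟨_, _, hδY, hY⟩ (m + 1) k'']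
      -- the envelopes of the leg chains (sup and unit gradient), at the weakened rate
      have hexp : ∀ (L : ℕ) (w z : Fin (3 + 1) → ℤ), Real.exp (-(κ₀ * supNorm (quo L w - z)))
          ≤ Real.exp (-(min κ₀ (min mK δin / 256) * supNorm (quo L w - z))) := fun L w z => by
        rw [Real.exp_le_exp]; nlinarith [supNorm_nonneg (quo L w - z)]
      have hl_env : ∀ α x' κ x, |legChain (fun j => rowM (KStepUnit (d := 3) Lc j) Lc) (m + 1) k'' α x' κ x| ≤
          Cr * ((((Lc ^ (k'' + 1) : ℕ) : ℝ)) ^ (3 + 2))⁻¹ * Real.exp (-(min κ₀ (min mK δin / 256) * supNorm (quo (Lc ^ (k'' + 1)) x - x'))) := by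
        intro α x' κ x
        rw [abs_legChain_rowM]
        exact (hN1 (m + 1) k'' α x' κ x).trans (mul_le_mul_of_nonneg_left (hexp _ _ _) (by positivity))
      have hr_env : ∀ μ y κ u, |legChain (fun j => colH (KStepUnit (d := 3) Lc j) Lc) (m + 1) k'' μ y κ u| ≤
          Cr * ((((Lc ^ (k'' + 1) : ℕ) : ℝ)) ^ (3 + 2))⁻¹ * Real.exp (-(min κ₀ (min mK δin / 256) * supNorm (quo (Lc ^ (k'' + 1)) u - y))) := by
        intro μ y κ u
        rw [legChain_colH]
        exact (hN1 (m + 1) k'' μ y κ u).trans (mul_le_mul_of_nonneg_left (hexp _ _ _) (by positivity))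
      have hl_grad : ∀ α x' κ x i, |legChain (fun j => rowM (KStepUnit (d := 3) Lc j) Lc) (m + 1) k'' α x' κ (x + Pi.single i 1)
            - legChain (fun j => rowM (KStepUnit (d := 3) Lc j) Lc) (m + 1) k'' α x' κ x| ≤
          Cr' * ((((Lc ^ (k'' + 1) : ℕ) : ℝ)) ^ (3 + 3))⁻¹ * Real.exp (-(min κ₀ (min mK δin / 256) * supNorm (quo (Lc ^ (k'' + 1)) x - x'))) := by
        intro α x' κ x i
        have e : |legChain (fun j => rowM (KStepUnit (d := 3) Lc j) Lc) (m + 1) k'' α x' κ (x + Pi.single i 1)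
            - legChain (fun j => rowM (KStepUnit (d := 3) Lc j) Lc) (m + 1) k'' α x' κ x|
            = |respStep (d := 3) (Lc ^ (m + 1)) (Lc ^ (m + 1 + k'' + 1)) α x' κ (x + Pi.single i 1)
              - respStep (d := 3) (Lc ^ (m + 1)) (Lc ^ (m + 1 + k'' + 1)) α x' κ x| := by
          rcases legChain_rowM (d := 3) (Lc := Lc) (m + 1) k'' with h | h
          · rw [h]
          · rw [h]
            simp only [Pi.neg_apply]
            rw [neg_sub_neg, abs_sub_comm]
        rw [e]
        exact (hN1' (m + 1) k'' α x' κ x i).trans (mul_le_mul_of_nonneg_left (hexp _ _ _) (by positivity))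
      have hr_grad : ∀ μ y κ u i, |legChain (fun j => colH (KStepUnit (d := 3) Lc j) Lc) (m + 1) k'' μ y κ (u + Pi.single i 1)
            - legChain (fun j => colH (KStepUnit (d := 3) Lc j) Lc) (m + 1) k'' μ y κ u| ≤
          Cr' * ((((Lc ^ (k'' + 1) : ℕ) : ℝ)) ^ (3 + 3))⁻¹ * Real.exp (-(min κ₀ (min mK δin / 256) * supNorm (quo (Lc ^ (k'' + 1)) u - y))) := by
        intro μ y κ u i
        rw [legChain_colH]
        exact (hN1' (m + 1) k'' μ y κ u i).trans (mul_le_mul_of_nonneg_left (hexp _ _ _) (by positivity))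
      have hL1 : 1 ≤ Lc ^ (k'' + 1) := Nat.one_le_pow _ _ hLc
      -- THE (T-irr) CORE at table period 1 and relative blocking `Lc^(k''+1)`
      have hpush := push₄_locStencil₂_of_zff_env (d := 3) (Lc := 1) (L := Lc ^ (k'' + 1)) hL1 hκ₁ hκ₁δ hCr hCr'
        hl_env hr_env hl_grad hr_grad hY hYcov hYZ
      have hsym := locStencil₂_symB hpush (by positivity)
      have hfin := locStencil₂_smul' ((-c) ^ (k'' + 1)) hsym
      refine locStencil₂_weaken hfin ?_ le_rfl
      -- the arithmetic: scalar of `k''+1` steps × four-leg count × ONE MORE `L⁻¹`, `L = Lc^(k''+1)`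
      rw [abs_pow, abs_neg, Nat.cast_pow]
      have hg := geom_le_one hLc hc (k'' + 1)
      have hP : 0 ≤ G * |c| * cS * C := by positivity
      have hLpow : (0 : ℝ) < (Lc : ℝ) ^ (k'' + 1) := by positivity
      have eL : (((Lc : ℝ) ^ (k'' + 1)) ^ (3 + 3))⁻¹ = ((((Lc : ℝ) ^ (k'' + 1)) ^ (3 + 2))⁻¹) * (((Lc : ℝ) ^ (k'' + 1)))⁻¹ := by
        rw [← mul_inv, ← pow_succ]
      have eρ : (((Lc : ℝ) ^ (k'' + 1)))⁻¹ = (Lc : ℝ) * ((Lc : ℝ)⁻¹) ^ (k'' + 1 + 1) := by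
        rw [pow_succ ((Lc : ℝ)⁻¹) (k'' + 1), inv_pow, ← mul_assoc, mul_comm (Lc : ℝ) _, mul_assoc, mul_inv_cancel₀ hLc0.ne', mul_one]
      calc |c| ^ (k'' + 1) * (cIrr 3 (min mK δin / 128) (min κ₀ (min mK δin / 256)) 1 * Cr ^ 3 * Cr' * (|c| * (cS * C)) *
            ((Lc : ℝ) ^ (k'' + 1)) ^ (3 + 1) * (((((Lc : ℝ) ^ (k'' + 1))) ^ (3 + 2))⁻¹) ^ 3 * ((((Lc : ℝ) ^ (k'' + 1))) ^ (3 + 3))⁻¹)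
          = (G * |c| * cS * C) * (|c| ^ (k'' + 1) * (((Lc : ℝ) ^ (k'' + 1)) ^ (3 + 1) * (((((Lc : ℝ) ^ (k'' + 1))) ^ (3 + 2))⁻¹) ^ 4)) *
            (((Lc : ℝ) ^ (k'' + 1)))⁻¹ := by rw [eL, hG]; ring
        _ ≤ (G * |c| * cS * C) * 1 * (((Lc : ℝ) ^ (k'' + 1)))⁻¹ :=
            mul_le_mul_of_nonneg_right (mul_le_mul_of_nonneg_left hg hP) (by positivity)
        _ = (G * |c| * cS) * C * ((Lc : ℝ) * ((Lc : ℝ)⁻¹) ^ (k'' + 1 + 1)) := by rw [eρ]; ring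
        _ ≤ (1 + |c| * cS * (1 + G)) * C * ((Lc : ℝ) * ((Lc : ℝ)⁻¹) ^ (k'' + 1 + 1)) := by
            refine mul_le_mul_of_nonneg_right (mul_le_mul_of_nonneg_right ?_ hC) (by positivity)
            nlinarith [mul_nonneg (abs_nonneg c) hcS]
        _ = (Lc : ℝ) * (1 + |c| * cS * (1 + G)) * C * ((Lc : ℝ)⁻¹) ^ (k'' + 1 + 1) := by ring

/-- **ROW W3-F3b IN THE PIN's OWN CURRENCY** (constants first, the pin `|cE₂| ≤ Lc^{2(3+1)}` VERBATIM as the hypothesis of the implication): for the scalar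
of record `c = cE₂·Lc^{2(3+1)}`. -/
theorem transport_irrelevant_pin (hLc : 1 ≤ Lc) (hK : UnitDecayK 3 Lc (sfStep Lc) (smStep 3 Lc) CK mK) (hmK : 0 < mK) (cE₂ : ℝ)
    (hA : ∀ j X κ u κ' u', A j X κ u κ' u' = -((cE₂ * (Lc : ℝ) ^ (2 * (3 + 1))) • mmRead Lc (comp (comp (KStepUnit (d := 3) Lc j)
      ((1 / 2 : ℝ) • (vertex2OfK (KStepUnit (d := 3) Lc j) Lc X κ u κ' u' + vertex2OfK (KStepUnit (d := 3) Lc j) Lc X κ' u' κ u)))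
      (KStepUnit (d := 3) Lc j))))
    {δin : ℝ} (hδin : 0 < δin) :
    ∃ CT δT : ℝ, 0 ≤ CT ∧ 0 < δT ∧ δT ≤ δin ∧ (|cE₂| ≤ (Lc : ℝ) ^ (2 * (3 + 1)) →
      ∀ (m k : ℕ) (X : BiTab 3) (C : ℝ), 0 ≤ C → LocStencil₂ X C δin →
      (∀ κ u κ' u' t, X κ (u + (Lc : ℤ) • t) κ' (u' + (Lc : ℤ) • t) = shiftK (-((Lc : ℤ) • t)) (X κ u κ' u')) →
      (∀ κ κ' κ₁ κ₂, zmode Lc X κ κ' (Sum.inl κ₁) (Sum.inl κ₂) = 0) →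
      LocStencil₂ (transport A m k X) (CT * C * ((Lc : ℝ)⁻¹) ^ k) δT) := by
  obtain ⟨CT, δT, hCT, hδT, hδTin, h⟩ := transport_irrelevant (c := cE₂ * (Lc : ℝ) ^ (2 * (3 + 1))) hLc hK hmK hA hδin
  refine ⟨CT, δT, hCT, hδT, hδTin, fun hpin => h ?_⟩
  have hL : (0 : ℝ) ≤ (Lc : ℝ) ^ (2 * (3 + 1)) := by positivity
  rw [abs_mul, abs_of_nonneg hL]
  calc |cE₂| * (Lc : ℝ) ^ (2 * (3 + 1)) ≤ (Lc : ℝ) ^ (2 * (3 + 1)) * (Lc : ℝ) ^ (2 * (3 + 1)) :=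
        mul_le_mul_of_nonneg_right hpin hL
    _ = (Lc : ℝ) ^ 16 := by rw [← pow_add]

/-- **ROW W3-F3b, LITERAL TRANSPORT OF RECORD** — `P m k := AffineUnroll.transport (fun j ↦ T2RecursionAffine.lin4 (cE₂·Lc^{2(3+1)}) (unitK (sfStep Lc j)
(smStep 3 Lc j) (KInvStep Lc j)) Lc) m k` (SKELETON-W3 v1.0.2 §8.3), constants first, the pin VERBATIM, the zero-mode hypothesis as «jointly
`Lc`-covariant ∧ `zmode Lc X κ κ′ (inl κ₁) (inl κ₂) = 0»: `transport_irrelevant_pin` with `hA := rfl`.  Inputs: `1 ≤ Lc`, the K-slot `UnitDecayK 3 Lc (sfStep Lc)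
(smStep 3 Lc) CK mK` (`mK > 0`), `δin > 0`. -/
theorem hTirr_three (hLc : 1 ≤ Lc) (hK : UnitDecayK 3 Lc (sfStep Lc) (smStep 3 Lc) CK mK) (hmK : 0 < mK) (cE₂ : ℝ) {δin : ℝ}
    (hδin : 0 < δin) :
    ∃ CT δT : ℝ, 0 ≤ CT ∧ 0 < δT ∧ δT ≤ δin ∧ (|cE₂| ≤ (Lc : ℝ) ^ (2 * (3 + 1)) →
      ∀ (m k : ℕ) (X : BiTab 3) (C : ℝ), 0 ≤ C → LocStencil₂ X C δin →
        (∀ κ u κ' u' t, X κ (u + (Lc : ℤ) • t) κ' (u' + (Lc : ℤ) • t) = shiftK (-((Lc : ℤ) • t)) (X κ u κ' u')) →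
        (∀ κ κ' κ₁ κ₂, zmode Lc X κ κ' (Sum.inl κ₁) (Sum.inl κ₂) = 0) →
        LocStencil₂ (transport (fun j => lin4 (cE₂ * (Lc : ℝ) ^ (2 * (3 + 1)))
          (unitK (sfStep Lc j) (smStep 3 Lc j) (KInvStep (d := 3) Lc j)) Lc) m k X) (CT * C * ((Lc : ℝ)⁻¹) ^ k) δT) :=
  transport_irrelevant_pin (A := fun j => lin4 (cE₂ * (Lc : ℝ) ^ (2 * (3 + 1))) (unitK (sfStep Lc j) (smStep 3 Lc j) (KInvStep (d := 3) Lc j)) Lc)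
    hLc hK hmK cE₂ (fun _ _ _ _ _ _ => rfl) hδin

/-- **ROW W3-F3b IN THE END's SLOT SHAPE** (`hTirr` of `WSlotT2OfPieces.shape_of_rows` ∕ `rate_of_rows`, whose `Zfree`, `mom`, `ρ` are PARAMETERS):
with `Zfree X := (X jointly Lc-covariant) ∧ (∀ κ κ′ κ₁ κ₂, zmode Lc X κ κ′ (inl κ₁) (inl κ₂) = 0)` written inline, ANY first-moment functional `mom` (unused —
(R14-3) `mom := fun _ ↦ 0`), and `ρ := Lc⁻¹`: under the pin, `∀ m k X C, 0 ≤ C → LocStencil₂ X C δin → Zfree X → mom X ≤ C → LocStencil₂ (P m k X) (CT′·C·ρ^k) δT`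
for the transport of record `P`. -/
theorem hTirr_three_slot (hLc : 1 ≤ Lc) (hK : UnitDecayK 3 Lc (sfStep Lc) (smStep 3 Lc) CK mK) (hmK : 0 < mK) (cE₂ : ℝ) {δin : ℝ}
    (hδin : 0 < δin) (mom : BiTab 3 → ℝ) :
    ∃ CT δT : ℝ, 0 ≤ CT ∧ 0 < δT ∧ δT ≤ δin ∧ (|cE₂| ≤ (Lc : ℝ) ^ (2 * (3 + 1)) →
      ∀ (m k : ℕ) (X : BiTab 3) (C : ℝ), 0 ≤ C → LocStencil₂ X C δin →
        ((∀ κ u κ' u' t, X κ (u + (Lc : ℤ) • t) κ' (u' + (Lc : ℤ) • t) = shiftK (-((Lc : ℤ) • t)) (X κ u κ' u')) ∧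
          (∀ κ κ' κ₁ κ₂, zmode Lc X κ κ' (Sum.inl κ₁) (Sum.inl κ₂) = 0)) → mom X ≤ C →
        LocStencil₂ (transport (fun j => lin4 (cE₂ * (Lc : ℝ) ^ (2 * (3 + 1)))
          (unitK (sfStep Lc j) (smStep 3 Lc j) (KInvStep (d := 3) Lc j)) Lc) m k X) (CT * C * ((Lc : ℝ)⁻¹) ^ k) δT) := by
  obtain ⟨CT, δT, hCT, hδT, hδTin, h⟩ := hTirr_three hLc hK hmK cE₂ hδin
  exact ⟨CT, δT, hCT, hδT, hδTin, fun hpin m k X C hC hX hZf _ => h hpin m k X C hC hX hZf.1 hZf.2⟩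

end Three

end Summit.QuantumFields.BalabanUV.Beta.GAN24.TransportIrrelevant

end
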